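import Mathlib.Analysis.InnerProductSpace.Adjoint
import Mathlib.Analysis.InnerProductSpace.PiL2
import Mathlib.Analysis.SpecialFunctions.Exp
import HarnessLib

/-!
# Frame bookkeeping of the covariant harmonic step: a linear map `D : V → W` in an eigenframe of `D†D`
# (covariant programme, brick c4(iii)-frame; the «SVD without a `W`-basis»)

Cell `ym-fleet`, crux `TwistedTraceScaling` (stmt-QuantumFields-20203), line «twolattice», stub S-BASE, lane B = COARSE-LOWER(L₁)
(design note `pub/ym-fleet/ym-20203-coarse-s1/LOWER-BLUEPRINT.md` §6, c4(iii)).  HONEST FRAMING: finite-dimensional linear algebra; fixed-lattice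
bookkeeping for a stub of a child of the CONDITIONAL reduction route (femto rung R2b1); not a gap, not Clay.

Setting: `V`, `W` finite-dimensional real inner-product spaces (links / plaquettes), `D : V →ₗ[ℝ] W` (the covariant linearised curl `D_U`),
`e` an orthonormal basis of `V` with `D†D eᵢ = λᵢ eᵢ` (ANY eigenframe — Mathlib's `LinearMap.IsSymmetric.eigenvectorBasis` of `D†D`, or an
explicit one such as lane A's twisted Fourier basis at an abelian background), `F : W` (the curvature), `φᵢ := ⟨D eᵢ, F⟩`, `wᵢ := ⟨eᵢ, w⟩`.

* `eigenvalue_eq_norm_sq` — `λᵢ = ‖D eᵢ‖²` (so `λᵢ ≥ 0`, and `λᵢ = 0 ↔ D eᵢ = 0`, whence `φᵢ = 0` on zero modes);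
* `inner_map_map` — `⟨D eᵢ, D eⱼ⟩ = λⱼ δᵢⱼ` (the `D eᵢ/√λᵢ`, `λᵢ ≠ 0`, are orthonormal in `W` — the singular value decomposition, never named);
* `norm_map_sq` — `‖D w‖² = Σᵢ λᵢ wᵢ²`; `inner_map_eq_sum` — `⟨F, D w⟩ = Σᵢ φᵢ wᵢ`; `inner_map_add` — `⟨D eᵢ, F + D w⟩ = φᵢ + λᵢ wᵢ`;
* ★ `norm_add_map_sq` — `‖F + D w‖² = ‖F‖² + Σᵢ (2φᵢ wᵢ + λᵢ wᵢ²)` (the step integrand FACTORISES over the modes);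
* ★ `norm_sub_map_sq_eq` — the DEFECT FORMULA `‖F − D x‖² = (‖F‖² − Σᵢ φᵢ²/λᵢ) + Σᵢ λᵢ (xᵢ − φᵢ/λᵢ)²` (Lean's `·/0 = 0` is harmless: `φᵢ = 0`
  whenever `λᵢ = 0`), hence `sum_sq_div_le_norm_sq` (Bessel: `Σᵢ φᵢ²/λᵢ ≤ ‖F‖²`) and `norm_sq_sub_sum_le` (`‖F‖² − Σᵢ φᵢ²/λᵢ ≤ ‖F − D x‖²`
  for EVERY `x`): `‖F‖² − Σᵢ φᵢ²/λᵢ = dist(F, range D)²` is the Bianchi defect, controlled by exhibiting any `x` with `D x ≈ F`;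
* ★ `stepIntegrand_eq_prod` — the model step integrand in product form:
  `e^{−b‖w‖²} e^{−t‖F + Dw‖²} e^{−Σᵢ ĉᵢ⟨Deᵢ, F + Dw⟩²} = e^{−t‖F‖²} · Πᵢ e^{−b wᵢ²} e^{−t(2φᵢwᵢ + λᵢwᵢ²)} e^{−ĉᵢ(φᵢ + λᵢwᵢ)²}`,
  ready for `Harm.integral_stepModes_pi` (file `…HarmonicStepMode`).

## References
* M. Lüscher, Nucl. Phys. B219 (1983) 233, §3 (normal modes). [Luscher1983]
* A. Wipf, *Statistical Approach to Quantum Field Theory*, LNP 992 (2021), §8.5.2 (8.64)–(8.67) (normal-mode factorisation). [Wipf2021]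
* R. A. Horn, C. R. Johnson, *Matrix Analysis* (2nd ed., 2013), Thm 7.3.2 (singular values via `D†D`). [HornJohnson2013]
-/

noncomputable section

open Real
open scoped RealInnerProductSpace

namespace Summit.QuantumFields.YangMills.Theorems.FemtoTransferGap.TwoLattice.Harm

variable {V W : Type*} [NormedAddCommGroup V] [InnerProductSpace ℝ V] [FiniteDimensional ℝ V]
  [NormedAddCommGroup W] [InnerProductSpace ℝ W] [FiniteDimensional ℝ W]
variable {ι : Type*} [Fintype ι]
variable {D : V →ₗ[ℝ] W} {e : OrthonormalBasis ι ℝ V} {lam : ι → ℝ}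

/-! ## §1 The eigenframe of `D†D` -/

/-- In an eigenframe of `D†D`: `λᵢ = ‖D eᵢ‖²`. [cite: HornJohnson2013, Thm 7.3.2] -/
theorem eigenvalue_eq_norm_sq (hD : ∀ i, D.adjoint (D (e i)) = lam i • e i) (i : ι) : lam i = ‖D (e i)‖ ^ 2 := by
  have h : ⟪e i, D.adjoint (D (e i))⟫ = ‖D (e i)‖ ^ 2 := by
    rw [LinearMap.adjoint_inner_right, real_inner_self_eq_norm_sq]
  rw [hD i, inner_smul_right, real_inner_self_eq_norm_sq, e.orthonormal.1 i, one_pow, mul_one] at h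
  exact h

/-- The eigenvalues are non-negative. [cite: HornJohnson2013, Thm 7.3.2] -/
theorem eigenvalue_nonneg (hD : ∀ i, D.adjoint (D (e i)) = lam i • e i) (i : ι) : 0 ≤ lam i := by
  rw [eigenvalue_eq_norm_sq hD i]; positivity

/-- A zero mode is killed by `D`: `λᵢ = 0 ↔ D eᵢ = 0`. [cite: HornJohnson2013, Thm 7.3.2] -/
theorem eigenvalue_eq_zero_iff (hD : ∀ i, D.adjoint (D (e i)) = lam i • e i) (i : ι) : lam i = 0 ↔ D (e i) = 0 := by
  rw [eigenvalue_eq_norm_sq hD i, sq_eq_zero_iff, norm_eq_zero]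

/-- On a zero mode every curvature coordinate vanishes: `λᵢ = 0 ⇒ φᵢ = ⟨D eᵢ, F⟩ = 0`. [cite: HornJohnson2013, Thm 7.3.2] -/
theorem inner_map_eq_zero_of_eigenvalue (hD : ∀ i, D.adjoint (D (e i)) = lam i • e i) {i : ι} (hi : lam i = 0) (F : W) :
    ⟪D (e i), F⟫ = 0 := by
  rw [(eigenvalue_eq_zero_iff hD i).mp hi, inner_zero_left]

/-- ★ The images `D eᵢ` are orthogonal with `‖D eᵢ‖² = λᵢ`: `⟨D eᵢ, D eⱼ⟩ = λⱼ δᵢⱼ` (the SVD of `D`, unnamed). [cite: HornJohnson2013, Thm 7.3.2] -/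
theorem inner_map_map (hD : ∀ i, D.adjoint (D (e i)) = lam i • e i) [DecidableEq ι] (i j : ι) :
    ⟪D (e i), D (e j)⟫ = if i = j then lam j else 0 := by
  rw [← LinearMap.adjoint_inner_right, hD j, inner_smul_right, orthonormal_iff_ite.mp e.orthonormal i j]
  split_ifs <;> simp

/-- `⟨D eᵢ, D w⟩ = λᵢ ⟨eᵢ, w⟩`. [cite: HornJohnson2013, Thm 7.3.2] -/
theorem inner_map_map_right (hD : ∀ i, D.adjoint (D (e i)) = lam i • e i) (i : ι) (w : V) :
    ⟪D (e i), D w⟫ = lam i * ⟪e i, w⟫ := by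
  rw [← LinearMap.adjoint_inner_left, hD i, inner_smul_left]
  rfl

/-! ## §2 The step in coordinates -/

/-- `D†D w = Σᵢ λᵢ wᵢ eᵢ`. [cite: Wipf2021, §8.5.2 (8.64)] -/
theorem adjoint_map_map_eq_sum (hD : ∀ i, D.adjoint (D (e i)) = lam i • e i) (w : V) :
    D.adjoint (D w) = ∑ i, (lam i * ⟪e i, w⟫) • e i := by
  conv_lhs => rw [← e.sum_repr' w]
  rw [map_sum, map_sum]
  refine Finset.sum_congr rfl fun i _ => ?_
  rw [map_smul, map_smul, hD i, smul_smul, mul_comm]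

/-- ★ `‖D w‖² = Σᵢ λᵢ wᵢ²`. [cite: Wipf2021, §8.5.2 (8.64)] -/
theorem norm_map_sq (hD : ∀ i, D.adjoint (D (e i)) = lam i • e i) (w : V) : ‖D w‖ ^ 2 = ∑ i, lam i * ⟪e i, w⟫ ^ 2 := by
  have h : ⟪w, D.adjoint (D w)⟫ = ‖D w‖ ^ 2 := by
    rw [LinearMap.adjoint_inner_right, real_inner_self_eq_norm_sq]
  rw [← h, adjoint_map_map_eq_sum hD w, inner_sum]
  refine Finset.sum_congr rfl fun i _ => ?_
  rw [inner_smul_right, real_inner_comm, sq]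
  ring

/-- ★ `⟨F, D w⟩ = Σᵢ φᵢ wᵢ`, `φᵢ = ⟨D eᵢ, F⟩`. [cite: Wipf2021, §8.5.2 (8.64)] -/
theorem inner_map_eq_sum (e : OrthonormalBasis ι ℝ V) (D : V →ₗ[ℝ] W) (F : W) (w : V) :
    ⟪F, D w⟫ = ∑ i, ⟪D (e i), F⟫ * ⟪e i, w⟫ := by
  rw [← LinearMap.adjoint_inner_left, ← e.sum_inner_mul_inner (D.adjoint F) w]
  refine Finset.sum_congr rfl fun i _ => ?_
  rw [real_inner_comm (e i) (D.adjoint F), LinearMap.adjoint_inner_right]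

/-- ★ The curvature coordinates after the step: `⟨D eᵢ, F + D w⟩ = φᵢ + λᵢ wᵢ`. [cite: Wipf2021, §8.5.2 (8.64)] -/
theorem inner_map_add (hD : ∀ i, D.adjoint (D (e i)) = lam i • e i) (i : ι) (F : W) (w : V) :
    ⟪D (e i), F + D w⟫ = ⟪D (e i), F⟫ + lam i * ⟪e i, w⟫ := by
  rw [inner_add_right, inner_map_map_right hD]

/-- ★ **THE STEP FACTORISES OVER THE MODES**: `‖F + D w‖² = ‖F‖² + Σᵢ (2φᵢ wᵢ + λᵢ wᵢ²)`. [cite: Wipf2021, §8.5.2 (8.64)–(8.65)] -/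
theorem norm_add_map_sq (hD : ∀ i, D.adjoint (D (e i)) = lam i • e i) (F : W) (w : V) :
    ‖F + D w‖ ^ 2 = ‖F‖ ^ 2 + ∑ i, (2 * ⟪D (e i), F⟫ * ⟪e i, w⟫ + lam i * ⟪e i, w⟫ ^ 2) := by
  rw [norm_add_sq_real, inner_map_eq_sum e D F w, norm_map_sq hD w, Finset.sum_add_distrib, Finset.mul_sum]
  simp only [mul_assoc]
  ring

/-- `‖F − D x‖² = ‖F‖² − 2Σᵢ φᵢ xᵢ + Σᵢ λᵢ xᵢ²`. [cite: Wipf2021, §8.5.2 (8.64)–(8.65)] -/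
theorem norm_sub_map_sq (hD : ∀ i, D.adjoint (D (e i)) = lam i • e i) (F : W) (x : V) :
    ‖F - D x‖ ^ 2 = ‖F‖ ^ 2 - 2 * ∑ i, ⟪D (e i), F⟫ * ⟪e i, x⟫ + ∑ i, lam i * ⟪e i, x⟫ ^ 2 := by
  rw [norm_sub_sq_real, inner_map_eq_sum e D F x, norm_map_sq hD x]

/-! ## §3 The Bianchi defect `‖F‖² − Σᵢ φᵢ²/λᵢ = dist(F, range D)²` without a projection -/

/-- One mode of the completed square: `−2φx + λx² = −φ²/λ + λ(x − φ/λ)²` — valid also for `λ = 0` provided `φ = 0` then (Lean: `·/0 = 0`).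
[folklore] -/
theorem mode_complete_square {lam φ : ℝ} (h : lam = 0 → φ = 0) (x : ℝ) :
    -(2 * (φ * x)) + lam * x ^ 2 = -(φ ^ 2 / lam) + lam * (x - φ / lam) ^ 2 := by
  by_cases hl : lam = 0
  · simp [hl, h hl]
  · field_simp
    ring

/-- ★ **THE DEFECT FORMULA**: `‖F − D x‖² = (‖F‖² − Σᵢ φᵢ²/λᵢ) + Σᵢ λᵢ (xᵢ − φᵢ/λᵢ)²`. [cite: HornJohnson2013, Thm 7.3.2] -/
theorem norm_sub_map_sq_eq (hD : ∀ i, D.adjoint (D (e i)) = lam i • e i) (F : W) (x : V) :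
    ‖F - D x‖ ^ 2 =
      (‖F‖ ^ 2 - ∑ i, ⟪D (e i), F⟫ ^ 2 / lam i) + ∑ i, lam i * (⟪e i, x⟫ - ⟪D (e i), F⟫ / lam i) ^ 2 := by
  rw [norm_sub_map_sq hD F x, Finset.mul_sum, sub_eq_add_neg, ← Finset.sum_neg_distrib, add_assoc, ← Finset.sum_add_distrib,
    sub_eq_add_neg, ← Finset.sum_neg_distrib, add_assoc, ← Finset.sum_add_distrib]
  congr 1
  exact Finset.sum_congr rfl fun i _ => mode_complete_square (fun hi => inner_map_eq_zero_of_eigenvalue hD hi F) _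

/-- ★ The defect is bounded by ANY trial preimage: `‖F‖² − Σᵢ φᵢ²/λᵢ ≤ ‖F − D x‖²` for every `x : V`. [cite: HornJohnson2013, Thm 7.3.2] -/
theorem norm_sq_sub_sum_le (hD : ∀ i, D.adjoint (D (e i)) = lam i • e i) (F : W) (x : V) :
    ‖F‖ ^ 2 - ∑ i, ⟪D (e i), F⟫ ^ 2 / lam i ≤ ‖F - D x‖ ^ 2 := by
  rw [norm_sub_map_sq_eq hD F x]
  have : 0 ≤ ∑ i, lam i * (⟪e i, x⟫ - ⟪D (e i), F⟫ / lam i) ^ 2 :=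
    Finset.sum_nonneg fun i _ => mul_nonneg (eigenvalue_nonneg hD i) (sq_nonneg _)
  linarith

/-- The optimal preimage `x_F = Σᵢ (φᵢ/λᵢ) eᵢ` realises the defect: `‖F − D x_F‖² = ‖F‖² − Σᵢ φᵢ²/λᵢ`. [cite: HornJohnson2013, Thm 7.3.2] -/
theorem norm_sub_map_optimal (hD : ∀ i, D.adjoint (D (e i)) = lam i • e i) (F : W) :
    ‖F - D (∑ i, (⟪D (e i), F⟫ / lam i) • e i)‖ ^ 2 = ‖F‖ ^ 2 - ∑ i, ⟪D (e i), F⟫ ^ 2 / lam i := by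
  rw [norm_sub_map_sq_eq hD F]
  have h : ∀ i, ⟪e i, ∑ j, (⟪D (e j), F⟫ / lam j) • e j⟫ = ⟪D (e i), F⟫ / lam i := fun i =>
    e.orthonormal.inner_right_fintype _ i
  simp only [h, sub_self, ne_eq, OfNat.ofNat_ne_zero, not_false_eq_true, zero_pow, mul_zero, Finset.sum_const_zero, add_zero]

/-- ★ BESSEL: `Σᵢ φᵢ²/λᵢ ≤ ‖F‖²` (equivalently `0 ≤` the defect). [cite: HornJohnson2013, Thm 7.3.2] -/
theorem sum_sq_div_le_norm_sq (hD : ∀ i, D.adjoint (D (e i)) = lam i • e i) (F : W) :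
    ∑ i, ⟪D (e i), F⟫ ^ 2 / lam i ≤ ‖F‖ ^ 2 := by
  have h := norm_sub_map_optimal hD F
  nlinarith [sq_nonneg ‖F - D (∑ i, (⟪D (e i), F⟫ / lam i) • e i)‖]

/-- The defect is non-negative and at most `‖F − Dx‖²` — two-sided packaging. [cite: HornJohnson2013, Thm 7.3.2] -/
theorem defect_mem_Icc (hD : ∀ i, D.adjoint (D (e i)) = lam i • e i) (F : W) (x : V) :
    0 ≤ ‖F‖ ^ 2 - ∑ i, ⟪D (e i), F⟫ ^ 2 / lam i ∧ ‖F‖ ^ 2 - ∑ i, ⟪D (e i), F⟫ ^ 2 / lam i ≤ ‖F - D x‖ ^ 2 :=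
  ⟨sub_nonneg.mpr (sum_sq_div_le_norm_sq hD F), norm_sq_sub_sum_le hD F x⟩

/-- If `F = D x` lies in the range, the defect vanishes: `Σᵢ ⟨Deᵢ, Dx⟩²/λᵢ = ‖D x‖²`. [cite: HornJohnson2013, Thm 7.3.2] -/
theorem sum_sq_div_eq_of_range (hD : ∀ i, D.adjoint (D (e i)) = lam i • e i) (x : V) :
    ∑ i, ⟪D (e i), D x⟫ ^ 2 / lam i = ‖D x‖ ^ 2 := by
  have h1 := norm_sq_sub_sum_le hD (D x) x
  have h2 := sum_sq_div_le_norm_sq hD (D x)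
  rw [sub_self, norm_zero] at h1
  linarith [sq_nonneg (0 : ℝ)]

/-! ## §4 The model step integrand in product form -/

omit [FiniteDimensional ℝ V] in
/-- `‖w‖² = Σᵢ wᵢ²` (Parseval). [folklore] -/
theorem norm_sq_eq_sum_coord (e : OrthonormalBasis ι ℝ V) (w : V) : ‖w‖ ^ 2 = ∑ i, ⟪e i, w⟫ ^ 2 :=
  (e.sum_sq_inner_right w).symm

/-- ★ **THE MODEL STEP INTEGRAND FACTORISES**: for weights `ĉᵢ` on the curvature coordinates,
`e^{−b‖w‖²} e^{−t‖F + Dw‖²} e^{−Σᵢ ĉᵢ⟨Deᵢ, F + Dw⟩²} = e^{−t‖F‖²} · Πᵢ e^{−b wᵢ²} e^{−t(2φᵢwᵢ + λᵢwᵢ²)} e^{−ĉᵢ(φᵢ + λᵢwᵢ)²}`.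
[cite: Wipf2021, §8.5.2 (8.64)–(8.67)] -/
theorem stepIntegrand_eq_prod (hD : ∀ i, D.adjoint (D (e i)) = lam i • e i) (t b : ℝ) (ĉ : ι → ℝ) (F : W) (w : V) :
    Real.exp (-(b * ‖w‖ ^ 2)) * Real.exp (-(t * ‖F + D w‖ ^ 2)) * Real.exp (-(∑ i, ĉ i * ⟪D (e i), F + D w⟫ ^ 2)) =
      Real.exp (-(t * ‖F‖ ^ 2)) *
        ∏ i, Real.exp (-(b * ⟪e i, w⟫ ^ 2)) * Real.exp (-(t * (2 * ⟪D (e i), F⟫ * ⟪e i, w⟫ + lam i * ⟪e i, w⟫ ^ 2))) *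
          Real.exp (-(ĉ i * (⟪D (e i), F⟫ + lam i * ⟪e i, w⟫) ^ 2)) := by
  have h1 : Real.exp (-(b * ‖w‖ ^ 2)) = Real.exp (∑ i, -(b * ⟪e i, w⟫ ^ 2)) := by
    rw [norm_sq_eq_sum_coord e w, Finset.mul_sum, ← Finset.sum_neg_distrib]
  have h2 : Real.exp (-(t * ‖F + D w‖ ^ 2)) =
      Real.exp (-(t * ‖F‖ ^ 2)) * Real.exp (∑ i, -(t * (2 * ⟪D (e i), F⟫ * ⟪e i, w⟫ + lam i * ⟪e i, w⟫ ^ 2))) := by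
    rw [norm_add_map_sq hD F w, mul_add, neg_add, Real.exp_add, Finset.mul_sum, ← Finset.sum_neg_distrib]
  have h3 : Real.exp (-(∑ i, ĉ i * ⟪D (e i), F + D w⟫ ^ 2)) =
      Real.exp (∑ i, -(ĉ i * (⟪D (e i), F⟫ + lam i * ⟪e i, w⟫) ^ 2)) := by
    rw [← Finset.sum_neg_distrib]
    simp only [inner_map_add hD]
  rw [h1, h2, h3, Real.exp_sum, Real.exp_sum, Real.exp_sum, Finset.prod_mul_distrib, Finset.prod_mul_distrib]
  ring

/-- The same with the weight written through `⟨Deᵢ, ·⟩²` on both sides and the `F`-potential `e^{−t‖F‖²}` moved in: the RATIO form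
`e^{−t‖F‖²}·[integrand] = e^{−2t‖F‖²} · Πᵢ (mode factors)`. [cite: Wipf2021, §8.5.2 (8.64)–(8.67)] -/
theorem potential_mul_stepIntegrand_eq_prod (hD : ∀ i, D.adjoint (D (e i)) = lam i • e i) (t b : ℝ) (ĉ : ι → ℝ) (F : W) (w : V) :
    Real.exp (-(t * ‖F‖ ^ 2)) *
        (Real.exp (-(b * ‖w‖ ^ 2)) * Real.exp (-(t * ‖F + D w‖ ^ 2)) * Real.exp (-(∑ i, ĉ i * ⟪D (e i), F + D w⟫ ^ 2))) =
      Real.exp (-(2 * t * ‖F‖ ^ 2)) *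
        ∏ i, Real.exp (-(b * ⟪e i, w⟫ ^ 2)) * Real.exp (-(t * (2 * ⟪D (e i), F⟫ * ⟪e i, w⟫ + lam i * ⟪e i, w⟫ ^ 2))) *
          Real.exp (-(ĉ i * (⟪D (e i), F⟫ + lam i * ⟪e i, w⟫) ^ 2)) := by
  rw [stepIntegrand_eq_prod hD, ← mul_assoc, ← Real.exp_add]
  congr 2
  ring

end Summit.QuantumFields.YangMills.Theorems.FemtoTransferGap.TwoLattice.Harm

end
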